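import Summits.BirchSwinnertonDyer.BirchSwinnertonDyer.Theorems.UniversalToricDescentStrictPlaceTupleSignature
import Summits.BirchSwinnertonDyer.BirchSwinnertonDyer.Theorems.UniversalToricDescentResidualSelmerExact
import HarnessLib

/-!
# Route UniversalToricDescent — the residual side of the (L)-free count: `ι⁻¹(G_rel^Σ) = H¹_{ur}(K_Σ/K_∞, E[p])`,
# the residual tuple signature, its kernel (the STRICT residual Selmer group) and the pull-back of `Sel_𝔭^Σ`

Lead prover bsd-wall-utd-p1 g13 (`--supports` ♭T′ stmt-BirchSwinnertonDyer-26975; step (γb2a) of the (L)-free residual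
comparison (M1) of stub B′ `stub_lambdaTransportPT`, memo RESIDUE-B-PRIME-utdp1g13 §3). Notation as in
`…StrictPlaceTupleSignature`: `H = ker κ`, `G = kerD κ 𝔭`, `M = E[p]`, `A = E[p^∞]`, `ι : H¹(H, M) → H¹(H, A)`,
`ι_G : H¹(G, M) → H¹(G, A)`, `G_rel^Σ = selmerAc W p κ v₀ Σ` (fake strict place `v₀ ∤ p`, `v₀ ∉ Σ`), exact index
`κ(D_𝔭) = p^c ℤ_p`, `Σ ⊇` the bad places prime to `p`, `K` totally complex.

* §1 `comap_torsionToPrimaryH1Sub_relaxed_eq_unramifiedOutside` — **`ι⁻¹(G_rel^Σ) = unramifiedOutside H M p Σ`**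
  (Greenberg–Vatsal's `H¹(ℚ_Σ/ℚ_∞, E[p])`): at a good `v ∉ Σ` «locally trivial for `A`» pulls back to «unramified for
  `M`» (`mem_unramifiedKer_of_torsionToPrimaryH1Sub_mem_awayKer` / `…_mem_awayKer_of_mem_unramifiedKer_kerSubgroup`), the
  archimedean clauses are vacuous, and `G_rel^Σ` has no clause above `p`. `E[p]`-INTRINSIC (no (L)).
* §2 `forall_fin_resKerD_conjH1_eq_zero_iff_mem_datumStrictSelmer` — for `u ∈ unramifiedOutside`: the residual tuple
  signature `(res_G conj_{γ^i} u)_{i<p^c}` vanishes iff `u` lies in the STRICT residual Selmer group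
  `datumStrictSelmer H M p (bdpData M p 𝔭) Σ` (whose cardinality is `E[p]`-intrinsic: `natCard_residualSelmer_eq_of_addEquiv`).
* §3 `mem_comap_selmerAc_iff_forall_fin_iota_resKerD_eq_zero` — for `u ∈ unramifiedOutside`: `ι u ∈ Sel_𝔭^Σ` iff
  `ι_G(res_G conj_{γ^i} u) = 0` for all `i` (naturality `ι_G ∘ res_G ∘ conj = res_G ∘ conj ∘ ι`).

So `#Sel_𝔭^Σ(A)[p] = #ι⁻¹(Sel_𝔭^Σ)` (p618609) is the number of `u ∈ unramifiedOutside` whose residual tuple signature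
lies in `(ker ι_G)^{p^c}`; the sequel counts them. THEOREMS ONLY; no definition, no named fact, no `sorry`. BSD is not
advanced by this file. References: [GreenbergVatsal2000] §2 pp. 16–17, 23, Prop. (2.8) (pp. 26–27); [GreenbergLNM1716]
§3 (proof of Lemma 3.1), §5 p. 114; [Castella2018] Def. 2.2.
-/

set_option autoImplicit false
-- `…BirchSwinnertonDyer.BirchSwinnertonDyer.Theorems…` is the problem's mandated namespace (D-0017).
set_option linter.dupNamespace false

noncomputable section

open scoped Classical

namespace Summit.BirchSwinnertonDyer.BirchSwinnertonDyer.Theorems.UniversalToricDescentStrictPlaceTuple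

open CategoryTheory Function Field NumberField IsDedekindDomain WeierstrassCurve
open Literature.NumberTheory.GaloisRepresentations Literature.NumberTheory.EllipticCurves
  Literature.NumberTheory.EllipticCurves.GreenbergSelmer Literature.NumberTheory.EllipticCurves.GreenbergVatsal2000
  Literature.NumberTheory.GaloisCohomology
  Summit.BirchSwinnertonDyer.Rank1Residual Summit.BirchSwinnertonDyer.Rank1Residual.X11b
  Summit.BirchSwinnertonDyer.Rank1Residual.X11b.Coinv Summit.BirchSwinnertonDyer.Rank1Residual.X11b.LocBridge
  Summit.BirchSwinnertonDyer.Rank1Residual.X11b.AcSelmer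
  Summit.BirchSwinnertonDyer.BirchSwinnertonDyer.Theorems.UniversalToricDescentSigmaLocalStabilizer
  Summit.BirchSwinnertonDyer.BirchSwinnertonDyer.Theorems.UniversalToricDescentSigmaLocalImage
  Summit.BirchSwinnertonDyer.BirchSwinnertonDyer.Theorems.UniversalToricDescentResidualSelmerFinite
  Summit.BirchSwinnertonDyer.BirchSwinnertonDyer.Theorems.UniversalToricDescentResidualSelmerLocal
  Summit.BirchSwinnertonDyer.BirchSwinnertonDyer.Theorems.UniversalToricDescentResidualSelmer
  Summit.BirchSwinnertonDyer.BirchSwinnertonDyer.Theorems.UniversalToricDescentResidualSelmerExact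

variable {K : Type} [Field K] [NumberField K] (W : WeierstrassCurve K) [W.IsElliptic] (p : ℕ)
  [Fact p.Prime] (κ : ZpExtension K p)

/-! ### §1 `ι⁻¹(G_rel^Σ) = unramifiedOutside H E[p] p Σ` -/

/-- **`ι⁻¹(G_rel^Σ) = H¹_{ur outside Σ∪{p}}(K_∞, E[p])`**: for `K` totally complex, `Σ ⊇` the bad places prime to `p`,
a fake strict place `v₀ ∤ p`, `v₀ ∉ Σ`: a class `y ∈ H¹(H, E[p])` maps into `G_rel^Σ = selmerAc W p κ v₀ Σ` iff its
conjugates are unramified at every good `v ∉ Σ`, `v ∤ p`. No hypothesis at `p`; `E[p]`-intrinsic.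
[cite: GreenbergVatsal2000, §2 pp. 16–17 and Prop. (2.8) (pp. 26–27)] [cite: GreenbergLNM1716, §3 (proof of Lemma 3.1)] -/
theorem comap_torsionToPrimaryH1Sub_relaxed_eq_unramifiedOutside [IsTotallyComplex K]
    {S : Set (HeightOneSpectrum (𝓞 K))}
    (hS : ∀ v : HeightOneSpectrum (𝓞 K), v ∉ S → ((p : ℕ) : 𝓞 K) ∉ v.asIdeal → W.HasGoodReductionAt v)
    {v₀ : HeightOneSpectrum (𝓞 K)} (hv₀ : ((p : ℕ) : 𝓞 K) ∉ v₀.asIdeal) (hv₀S : v₀ ∉ S) :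
    (selmerAc W p κ v₀ S).comap (W.torsionToPrimaryH1Sub p κ.kerSubgroup) =
      unramifiedOutside κ.kerSubgroup (W.geomTorsion (p : ℤ)) p S := by
  ext y
  rw [AddSubgroup.mem_comap, mem_unramifiedOutside_iff]
  constructor
  · intro hy v hvS hpv σ
    have hyS := (mem_selmerOver_iff_awayKer _ _ _).mp hy
    have hpv' : (p : 𝓞 K) ∉ v.asIdeal := hpv
    refine mem_unramifiedKer_of_torsionToPrimaryH1Sub_mem_awayKer W p κ.kerSubgroup (hS v hvS hpv) hpv' ?_
    rw [← WeierstrassCurve.conjH1_torsionToPrimaryH1Sub]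
    exact hyS.1 v hpv hvS σ
  · intro hy
    change W.torsionToPrimaryH1Sub p κ.kerSubgroup y ∈ selmerOver κ.kerSubgroup (W.geomPrimaryTorsion p) p v₀ S
    rw [mem_selmerOver_iff_awayKer]
    have haway : ∀ (v : HeightOneSpectrum (𝓞 K)), ((p : ℕ) : 𝓞 K) ∉ v.asIdeal → v ∉ S →
        ∀ σ : absoluteGaloisGroup K, W.conjH1 p κ.kerSubgroup σ (W.torsionToPrimaryH1Sub p κ.kerSubgroup y) ∈
          awayKer κ.kerSubgroup (W.geomPrimaryTorsion p) v := by
      intro v hpv hvS σ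
      rw [WeierstrassCurve.conjH1_torsionToPrimaryH1Sub]
      exact torsionToPrimaryH1Sub_mem_awayKer_of_mem_unramifiedKer_kerSubgroup W p κ (by exact_mod_cast hpv)
        (hS v hvS hpv) (hy v hvS hpv σ)
    exact ⟨haway, fun w σ ↦ mem_infKer_of_decompInf_eq_bot w
      (decompInf_eq_bot_of_isComplex (IsTotallyComplex.isComplex w)) _, haway v₀ hv₀ hv₀S⟩

/-! ### §2 The kernel of the residual tuple signature is the strict residual Selmer group -/

omit [W.IsElliptic] in
/-- **For `u ∈ unramifiedOutside H E[p] p Σ`: `res_G(conj_{γ^i} u) = 0` for all `i < p^c` iff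
`u ∈ datumStrictSelmer H E[p] p (bdpData) Σ`** (the STRICT residual Selmer group: unramified outside `Σ ∪ {p}`,
locally trivial at every place above `𝔭`, nothing at the other places above `p`). `Γ_K = D_𝔭 γ^{<p^c} H`.
[cite: GreenbergVatsal2000, §2 pp. 16–17, 20] [cite: Castella2018, Def. 2.2 (arXiv:1704.06608 p. 5)] -/
theorem forall_fin_resKerD_conjH1_eq_zero_iff_mem_datumStrictSelmer {γ : absoluteGaloisGroup K}
    (hγ : κ.IsTopGenerator γ) {𝔭 : HeightOneSpectrum (𝓞 K)} (h𝔭 : ((p : ℕ) : 𝓞 K) ∈ 𝔭.asIdeal) {c : ℕ}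
    (hc : ∀ z : ℤ_[p], ∃ d : decomp (K := K) 𝔭, (κ (d : absoluteGaloisGroup K)).toAdd = (p : ℤ_[p]) ^ c * z)
    {S : Set (HeightOneSpectrum (𝓞 K))}
    {u : Literature.NumberTheory.EllipticCurves.subgroupH1 κ.kerSubgroup (W.geomTorsion (p : ℤ))}
    (hu : u ∈ unramifiedOutside κ.kerSubgroup (W.geomTorsion (p : ℤ)) p S) :
    (∀ i : Fin (p ^ c), resKerD κ (W.geomTorsion (p : ℤ)) 𝔭
        (Literature.NumberTheory.EllipticCurves.conjH1 κ.kerSubgroup (W.geomTorsion (p : ℤ)) (γ ^ (i : ℕ)) u) = 0) ↔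
      u ∈ datumStrictSelmer κ.kerSubgroup (W.geomTorsion (p : ℤ)) p (AcSelmer.bdpData _ p 𝔭) S := by
  -- all conjugates from the `p^c` representatives
  have hall : (∀ i : Fin (p ^ c), resKerD κ (W.geomTorsion (p : ℤ)) 𝔭
        (Literature.NumberTheory.EllipticCurves.conjH1 κ.kerSubgroup (W.geomTorsion (p : ℤ)) (γ ^ (i : ℕ)) u) = 0) ↔
      ∀ σ : absoluteGaloisGroup K, resKerD κ (W.geomTorsion (p : ℤ)) 𝔭
        (Literature.NumberTheory.EllipticCurves.conjH1 κ.kerSubgroup (W.geomTorsion (p : ℤ)) σ u) = 0 := by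
    constructor
    · intro h σ
      obtain ⟨d, n, h', hn, hh, rfl⟩ := exists_decomp_mul_pow_lt_mul_mem_ker κ hγ 𝔭 hc σ
      rw [Literature.NumberTheory.EllipticCurves.conjH1_mul_holds κ.kerSubgroup (W.geomTorsion (p : ℤ)),
        AddMonoidHom.comp_apply,
        Literature.NumberTheory.EllipticCurves.conjH1_of_mem_holds κ.kerSubgroup (W.geomTorsion (p : ℤ)) hh,
        AddMonoidHom.id_apply,
        Literature.NumberTheory.EllipticCurves.conjH1_mul_holds κ.kerSubgroup (W.geomTorsion (p : ℤ)),
        AddMonoidHom.comp_apply, resKerD_conjH1, h ⟨n, hn⟩, map_zero]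
    · exact fun h i ↦ h _
  rw [hall, mem_datumStrictSelmer_iff]
  constructor
  · intro h0
    refine ⟨hu, fun v hv σ ↦ ?_⟩
    by_cases hv𝔭 : v = 𝔭
    · subst hv𝔭
      rw [AcSelmer.bdpData_self p v hv, mem_strictKer_strictDatum_iff_mem_awayKer, mem_awayKer_iff_resKerD_eq_zero]
      exact h0 σ
    · rw [AcSelmer.bdpData_of_ne p 𝔭 hv hv𝔭, AcSelmer.strictKer_relaxedDatum_eq_top]
      exact AddSubgroup.mem_top _
  · rintro ⟨-, h⟩ σ
    have h' := h 𝔭 h𝔭 σ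
    rw [AcSelmer.bdpData_self p 𝔭 h𝔭, mem_strictKer_strictDatum_iff_mem_awayKer, mem_awayKer_iff_resKerD_eq_zero] at h'
    exact h'

/-! ### §3 The pull-back of `Sel_𝔭^Σ` in terms of the residual tuple signature -/

/-- **For `u ∈ unramifiedOutside H E[p] p Σ` (`= ι⁻¹(G_rel^Σ)`): `ι u ∈ Sel_𝔭^Σ` iff `ι_G(res_G conj_{γ^i} u) = 0` for all
`i < p^c`** (the kernel of the tuple signature on `G_rel^Σ` is `Sel_𝔭^Σ`; naturality of `ι`).
[cite: GreenbergVatsal2000, §2 Prop. (2.8) (pp. 26–27)] [cite: GreenbergLNM1716, §5 p. 114] -/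
theorem mem_comap_selmerAc_iff_forall_fin_iota_resKerD_eq_zero [IsTotallyComplex K] {γ : absoluteGaloisGroup K}
    (hγ : κ.IsTopGenerator γ) {𝔭 : HeightOneSpectrum (𝓞 K)} {c : ℕ}
    (hc : ∀ z : ℤ_[p], ∃ d : decomp (K := K) 𝔭, (κ (d : absoluteGaloisGroup K)).toAdd = (p : ℤ_[p]) ^ c * z)
    {S : Set (HeightOneSpectrum (𝓞 K))}
    (hS : ∀ v : HeightOneSpectrum (𝓞 K), v ∉ S → ((p : ℕ) : 𝓞 K) ∉ v.asIdeal → W.HasGoodReductionAt v)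
    {v₀ : HeightOneSpectrum (𝓞 K)} (hv₀ : ((p : ℕ) : 𝓞 K) ∉ v₀.asIdeal) (hv₀S : v₀ ∉ S)
    {u : Literature.NumberTheory.EllipticCurves.subgroupH1 κ.kerSubgroup (W.geomTorsion (p : ℤ))}
    (hu : u ∈ unramifiedOutside κ.kerSubgroup (W.geomTorsion (p : ℤ)) p S) :
    W.torsionToPrimaryH1Sub p κ.kerSubgroup u ∈ selmerAc W p κ 𝔭 S ↔
      ∀ i : Fin (p ^ c), resH1Hom (ContinuousMonoidHom.id (kerD κ 𝔭))
          (AddSubgroup.inclusion (geomTorsion_le_geomPrimaryTorsion W p)) (fun _ _ ↦ rfl)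
          (resKerD κ (W.geomTorsion (p : ℤ)) 𝔭
            (Literature.NumberTheory.EllipticCurves.conjH1 κ.kerSubgroup (W.geomTorsion (p : ℤ)) (γ ^ (i : ℕ)) u)) = 0 := by
  have hrel : W.torsionToPrimaryH1Sub p κ.kerSubgroup u ∈ selmerAc W p κ v₀ S := by
    have h : u ∈ (selmerAc W p κ v₀ S).comap (W.torsionToPrimaryH1Sub p κ.kerSubgroup) := by
      rw [comap_torsionToPrimaryH1Sub_relaxed_eq_unramifiedOutside W p κ hS hv₀ hv₀S]; exact hu
    exact h
  rw [mem_selmerAc_iff_forall_fin_of_mem_relaxed W p κ hγ hc hrel]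
  refine forall_congr' fun i ↦ ?_
  rw [resKerD_iota_comm, ← WeierstrassCurve.conjH1_torsionToPrimaryH1Sub]

end Summit.BirchSwinnertonDyer.BirchSwinnertonDyer.Theorems.UniversalToricDescentStrictPlaceTuple

end
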